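import Summits.BirchSwinnertonDyer.BirchSwinnertonDyer.Theorems.EisensteinDepletionAtTwoStarCuspValues
import HarnessLib

/-!
# Route `EisensteinDepletionAtTwo`, crux E1M `DepletedLambdaLawAtTwoMod` (stmt-BirchSwinnertonDyer-20341), line `star`:
# the CONGRUENCE-CHARACTER TRANSFER — (★-SymbC) for a class follows from a mod-2 congruence of the two period functions on
# `Γ₀(N)` UP TO ANY FUNCTION OF THE LOWER-RIGHT ENTRY, plus one odd symbol value on `C`

Cell `bsd-rank2` (HOME run/shared/lean/pub/bsd-rank2/), seat `bsd-rank2-eng` GEN 10 (helper `--supports` the crux item; does NOT close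
the research stub `stub_starSymbC`). WHY THIS SHAPE: the seat's certified census (kit j291759, HOME/bsd-rank2-eng/data/cert4/) shows
that for every habitat isogeny class of odd conductor `N ≤ 2000` except `15a` the two HOMOMORPHISMS `Γ₀(N) → ℤ`
`γ ↦ φ_β(γ)/c_F` (period of the `β`-stabilised Eisenstein series) and `γ ↦ ([γ·0]⁺_f − [0]⁺_f)/c_L` (plus period of the newform `f`
of the class) agree modulo `2` UP TO A CHARACTER `χ(d)` of the lower-right entry (`χ = 1` or a product of Legendre symbols `(d/p)`,
`p ∣ N` — the Shimura-subgroup correction of p2 GEN 21's Serre-dlog theorem (S)+(CΣ)); at `15a` the same holds one 2-adic digit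
deeper (`Rank2.LevelFifteen.eisPeriod15_law_gamma0`, `(15/4)·φ ≡ n₁ + ψ(d) (mod 4)`). This file is the FORMAL TRANSFER from that
group-level congruence to the registered dyadic statement: since the Bézout matrices `γ_{a,2^m}` and `γ_{1,2^m}` of the two cusps of a
`C`-pair have THE SAME lower-right entry `2^m`, ANY `d`-dependent correction cancels in the difference — no homomorphism property and no
character theory is needed for the transfer itself.

* **`sameOnC_of_periodCongruence`** — for odd `M`, any `β`, any cusp form `f`, scales `c_F, c_L ≠ 0` and ANY function `χ : ℤ → ZMod 2`:
  if for every `γ = (x, b; c, d) ∈ SL(2, ℤ)` with `M ∣ c`, `d = 2^m` (`m ≥ 3`) and `b` odd, `φ_β(γ) = n_F·c_F` and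
  `[b/d]⁺_f − [0]⁺_f = n_L·c_L` with `n_F ≡ n_L + χ(d) (mod 2)`, and some `(m, a) ∈ C` has `([a/2^m]⁺_f − [1/2^m]⁺_f)/c_L` odd, then
  `SameOnCModTwo (plusCuspDiff f) (stabEisCuspDiff M β)` holds (unfolded, in the shape of `StarSymbC` / `star_glueFin`).

THEOREMS ONLY; no `sorry`; standard axioms. PARTITION: none — r_an ≥ 2, summit axis S0 (D-0036(1)); TWIN (D-0056): n/a.
B1 honesty: elementary bookkeeping of Bézout matrices; nothing reads an analytic rank; no S0 motion; the research congruence itself,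
(★-SymbC), (★), E1M and BSD are NOT proved by this.

References: G. Stevens, *Arithmetic on Modular Curves*, Progr. Math. 20 (1982) §2.5 eq. (2.5.3), §3 [Stevens1982];
B. Mazur, J. Tate, J. Teitelbaum, *Invent. Math.* 84 (1986) §I.10 [MazurTateTeitelbaum1986Invent].
-/

set_option linter.dupNamespace false

noncomputable section

open scoped MatrixGroups ModularForm

open CongruenceSubgroup Matrix.SpecialLinearGroup
open Literature.NumberTheory.ModularForms Literature.NumberTheory.EllipticCurves
  Literature.NumberTheory.EllipticCurves.ModularForms

namespace Summit.BirchSwinnertonDyer.BirchSwinnertonDyer.Theorems.DepletionAtTwo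

/-- **The Bézout matrix `γ_{b,2^m} = (x, b; −M y, 2^m)` of the tree (`gammaEntries`) as an element of `SL(2, ℤ)`** (odd `M`, odd `b`):
its entries are literally those inside `stabEisCuspDiff M β m b`. [cite: Stevens1982, §2.5 eq. (2.5.3) (PDF p. 38)] -/
theorem exists_sl_gammaEntries {M : ℕ} (hM : Odd M) (m : ℕ) {b : ℤ} (hb : Odd b) :
    ∃ γ : SL(2, ℤ), γ 0 0 = Int.gcdA ((2 ^ m : ℕ) : ℤ) (b * M) ∧ γ 0 1 = b ∧
      γ 1 0 = -(M : ℤ) * Int.gcdB ((2 ^ m : ℕ) : ℤ) (b * M) ∧ γ 1 1 = ((2 ^ m : ℕ) : ℤ) := by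
  have hg := Int.gcd_eq_gcd_ab ((2 ^ m : ℕ) : ℤ) (b * M)
  rw [int_gcd_two_pow_eq_one hM hb m] at hg
  push_cast at hg
  refine ⟨⟨!![Int.gcdA ((2 ^ m : ℕ) : ℤ) (b * M), b; -(M : ℤ) * Int.gcdB ((2 ^ m : ℕ) : ℤ) (b * M), ((2 ^ m : ℕ) : ℤ)],
    by rw [Matrix.det_fin_two_of]; push_cast; linear_combination -hg⟩, rfl, rfl, rfl, rfl⟩

/-- **THE CONGRUENCE-CHARACTER TRANSFER.** For odd `M`, a stabilisation datum `β`, a weight-2 cusp form `f`, nonzero scales `c_F, c_L`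
and ANY correction `χ : ℤ → ZMod 2` of the lower-right entry: if on every matrix `γ = (x, b; c, 2^m) ∈ SL(2, ℤ)` with `M ∣ c`,
`m ≥ 3`, `b` odd, the Eisenstein period and the plus cusp period are `φ_β(γ) = n_F·c_F`, `[b/2^m]⁺_f − [0]⁺_f = n_L·c_L` with
`n_F ≡ n_L + χ(2^m) (mod 2)`, and some `(m, a) ∈ C` has an odd `([a/2^m]⁺ − [1/2^m]⁺)/c_L`, then (★-SymbC) holds for `(f, M, β)`:
`plusCuspDiff f` and `stabEisCuspDiff M β` agree mod `2` on `C` in the normalisations `c_L, c_F`, with an odd symbol value.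
(The two Bézout matrices of a `C`-pair share `d = 2^m`, so `χ` cancels.) [cite: Stevens1982, §2.5 (PDF p. 38)]
[cite: MazurTateTeitelbaum1986Invent, §I.10 (10.1)] -/
theorem sameOnC_of_periodCongruence {M : ℕ} (hM : Odd M) (β : ℕ → ℕ) ⦃N : ℕ⦄ (f : CuspForm (Gamma0 N) 2)
    (cF cL : ℚ) (hcF : cF ≠ 0) (hcL : cL ≠ 0) (χ : ℤ → ZMod 2)
    (h : ∀ (γ : SL(2, ℤ)) (m : ℕ), 3 ≤ m → (M : ℤ) ∣ γ 1 0 → γ 1 1 = ((2 ^ m : ℕ) : ℤ) → Odd (γ 0 1) →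
      ∃ nF nL : ℤ, stabEisensteinPeriod M β (γ 0 0) (γ 0 1) (γ 1 0) (γ 1 1) = nF * cF ∧
        ratPlusSymbol f ((γ 0 1 : ℚ) / (2 ^ m : ℕ)) - ratPlusSymbol f 0 = nL * cL ∧
        (nF : ZMod 2) = (nL : ZMod 2) + χ (γ 1 1))
    (hwit : ∃ m a, InC m a ∧ ∃ n : ℤ, plusCuspDiff f m a = n * cL ∧ Odd n) :
    ∃ g g' : ℚ, g ≠ 0 ∧ g' ≠ 0 ∧
      (∀ m a, InC m a → ∃ n n' : ℤ, plusCuspDiff f m a = n * g ∧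
        stabEisCuspDiff M β m a = n' * g' ∧ (n : ZMod 2) = (n' : ZMod 2)) ∧
      (∃ m a, InC m a ∧ ∃ n : ℤ, plusCuspDiff f m a = n * g ∧ Odd n) := by
  refine ⟨cL, cF, hcL, hcF, fun m a hma ↦ ?_, hwit⟩
  obtain ⟨hm, ha4, -, -⟩ := hma
  have ha : Odd a := Int.odd_iff.mpr (by omega)
  obtain ⟨γa, ha00, ha01, ha10, ha11⟩ := exists_sl_gammaEntries hM m ha
  obtain ⟨γ1, h100, h101, h110, h111⟩ := exists_sl_gammaEntries hM m odd_one
  obtain ⟨nFa, nLa, hFa, hLa, hpa⟩ := h γa m hm (by rw [ha10]; exact ⟨-Int.gcdB _ _, by ring⟩) ha11 (by rw [ha01]; exact ha)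
  obtain ⟨nF1, nL1, hF1, hL1, hp1⟩ := h γ1 m hm (by rw [h110]; exact ⟨-Int.gcdB _ _, by ring⟩) h111 (by rw [h101]; exact odd_one)
  rw [ha00, ha01, ha10, ha11] at hFa
  rw [ha01] at hLa
  rw [ha11] at hpa
  rw [h100, h101, h110, h111] at hF1
  rw [h101] at hL1
  rw [h111] at hp1
  refine ⟨nLa - nL1, nFa - nF1, ?_, ?_, ?_⟩
  · -- the curve side: `[a/2^m]⁺ − [1/2^m]⁺ = (nL_a − nL_1)·c_L`
    unfold plusCuspDiff
    push_cast at hLa hL1 ⊢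
    linear_combination hLa - hL1
  · -- the Eisenstein side: `v(m,a) = φ(γ_a) − φ(γ_1) = (nF_a − nF_1)·c_F`
    rw [stabEisCuspDiff_eq, one_mul, hFa]
    have hF1' : stabEisensteinPeriod M β (Int.gcdA ((2 ^ m : ℕ) : ℤ) (M : ℤ)) 1
        (-(M : ℤ) * Int.gcdB ((2 ^ m : ℕ) : ℤ) (M : ℤ)) ((2 ^ m : ℕ) : ℤ) = nF1 * cF := by
      simpa only [one_mul] using hF1
    rw [hF1']
    push_cast
    ring
  · -- the correction `χ(2^m)` is the same for both matrices
    push_cast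
    rw [hpa, hp1]
    ring

end Summit.BirchSwinnertonDyer.BirchSwinnertonDyer.Theorems.DepletionAtTwo

end
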